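import Summits.KontsevichZagierPeriods.KontsevichZagierPeriods.Theorems.FermatIsogenyBetaProductSectorDefs

/-!
# `BetaProductSector` (stmt-KontsevichZagierPeriods-3898), line `registered` v3 — the named schemas ARE fully uniform moves

Sanity theorems for the vocabulary of `Theorems/FermatIsogenyBetaProductSectorDefs.lean` (lead c3): the Γ-divisor criterion
`IsFullyUniform` (divisor AND constant part vanish) holds, for ALL rational parameters, for the slope data of
* the quadratic move QUAD `((x,y),(x+½,y)) ~ ((2x,2y),(½,y))` along the direction `(x,y) ↦ (x+t, y+t)` (slopes `1 1 1 1 | 2 2 0 1`),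
* the two-duplication move DD `((c+½−d, 2c+2d),(c,d)) ~ ((2c, c+d+½),(c+½−d, d))` along `c ↦ c+t` (slopes `1 2 1 0 | 2 1 1 0`),
* the twin-duplication move X9 `((a+b−½, b+½),(b, a+½−b)) ~ ((a+b−½, a+½−b),(a, 2b))` along `(a,b) ↦ (a+t,b+t)`
  (slopes `2 1 1 0 | 2 0 1 2`),
so that the landed / registered KZ theorems `stub_quadStep`, `stub_ddStep`, `stub_twinDupStep` are instances of the registered
stub `stub_uniformStep` (UNIF). Pure `Finsupp` bookkeeping: every divisor term is a sum of at most three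
`Finsupp.single (Int.fract _) (±1)` and the points pair off after `Int.fract` absorbs integer shifts.
-/

noncomputable section

namespace Summit.KontsevichZagierPeriods.FermatIsogeny.BetaProductSectorStubs

open Summit.KontsevichZagierPeriods.FermatIsogeny.BetaProductSectorDefs

/-! ## Unfolding the divisor and constant terms at small slopes -/

/-- `divisorTerm α 0 e = 0`. [folklore] -/
theorem divisorTerm_zero (α : ℚ) (e : ℤ) : divisorTerm α 0 e = 0 := by
  simp [divisorTerm]

/-- `divisorTerm α 1 e = [ {α} ]·e`. [folklore] -/
theorem divisorTerm_one (α : ℚ) (e : ℤ) : divisorTerm α 1 e = Finsupp.single (Int.fract α) e := by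
  have h1 : (1:ℤ).natAbs = 1 := rfl
  have hs : (1:ℤ).sign = 1 := rfl
  rw [divisorTerm, if_neg (by norm_num), h1, hs, Finset.sum_range_succ, Finset.sum_range_zero, zero_add, mul_one]
  push_cast
  congr 2; ring

/-- `divisorTerm α 2 e = [ {α/2} ]·e + [ {α/2 + ½} ]·e`. [folklore] -/
theorem divisorTerm_two (α : ℚ) (e : ℤ) :
    divisorTerm α 2 e = Finsupp.single (Int.fract (α / 2)) e + Finsupp.single (Int.fract (α / 2 + 1 / 2)) e := by
  have h2 : (2:ℤ).natAbs = 2 := rfl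
  have hs : (2:ℤ).sign = 1 := rfl
  rw [divisorTerm, if_neg (by norm_num), h2, hs, Finset.sum_range_succ, Finset.sum_range_succ, Finset.sum_range_zero,
    zero_add, mul_one]
  push_cast
  congr 2 <;> ring

/-- `divisorTerm α 3 e = [ {α/3} ]·e + [ {α/3 + ⅓} ]·e + [ {α/3 + ⅔} ]·e`. [folklore] -/
theorem divisorTerm_three (α : ℚ) (e : ℤ) :
    divisorTerm α 3 e = Finsupp.single (Int.fract (α / 3)) e + Finsupp.single (Int.fract (α / 3 + 1 / 3)) e +
      Finsupp.single (Int.fract (α / 3 + 2 / 3)) e := by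
  have h3 : (3:ℤ).natAbs = 3 := rfl
  have hs : (3:ℤ).sign = 1 := rfl
  rw [divisorTerm, if_neg (by norm_num), h3, hs, Finset.sum_range_succ, Finset.sum_range_succ, Finset.sum_range_succ,
    Finset.sum_range_zero, zero_add, mul_one]
  push_cast
  have e1 : ((1:ℚ) * α + 0) / 3 = α / 3 := by ring
  have e2 : ((1:ℚ) * α + 1) / 3 = α / 3 + 1 / 3 := by ring
  have e3 : ((1:ℚ) * α + 2) / 3 = α / 3 + 2 / 3 := by ring
  rw [e1, e2, e3]

/-- A slope-`0` test: `constTerm α m e = 0` when `m ≠ 0`. [folklore] -/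
theorem constTerm_of_ne_zero (α : ℚ) {m : ℤ} (hm : m ≠ 0) (e : ℤ) : constTerm α m e = 0 := by
  simp [constTerm, hm]

/-- `constTerm (1/2) 0 e = 0` (half-integers are dropped). [folklore] -/
theorem constTerm_half (e : ℤ) : constTerm (1 / 2) 0 e = 0 := by
  have h : Int.fract ((1:ℚ) / 2) = 1 / 2 := by norm_num [Int.fract_eq_iff]
  rw [constTerm, if_pos (Or.inr (Or.inr h))]

/-- `divisorTerm α 4 e = Σ_{j<4} [ {α/4 + j/4} ]·e`. [folklore] -/
theorem divisorTerm_four (α : ℚ) (e : ℤ) :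
    divisorTerm α 4 e = Finsupp.single (Int.fract (α / 4)) e + Finsupp.single (Int.fract (α / 4 + 1 / 4)) e +
      Finsupp.single (Int.fract (α / 4 + 2 / 4)) e + Finsupp.single (Int.fract (α / 4 + 3 / 4)) e := by
  have h4 : (4:ℤ).natAbs = 4 := rfl
  have hs : (4:ℤ).sign = 1 := rfl
  rw [divisorTerm, if_neg (by norm_num), h4, hs, Finset.sum_range_succ, Finset.sum_range_succ, Finset.sum_range_succ,
    Finset.sum_range_succ, Finset.sum_range_zero, zero_add, mul_one]
  push_cast
  have e1 : ((1:ℚ) * α + 0) / 4 = α / 4 := by ring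
  have e2 : ((1:ℚ) * α + 1) / 4 = α / 4 + 1 / 4 := by ring
  have e3 : ((1:ℚ) * α + 2) / 4 = α / 4 + 2 / 4 := by ring
  have e4 : ((1:ℚ) * α + 3) / 4 = α / 4 + 3 / 4 := by ring
  rw [e1, e2, e3, e4]

/-! ## The quadratic move is fully uniform -/

/-- **QUAD is a fully uniform move**: along `(x,y) ↦ (x+t,y+t)` the quadratic move `((x,y),(x+½,y)) ~ ((2x,2y),(½,y))` has
vanishing Γ-divisor and vanishing constant part, for all rational `x, y`. [cite: AndrewsAskeyRoy1999, Thm 1.5.1] -/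
theorem quad_isFullyUniform : ∀ (x y : ℚ), Summit.KontsevichZagierPeriods.FermatIsogeny.BetaProductSectorDefs.IsFullyUniform x y (x + 1 / 2) y (2 * x) (2 * y) (1 / 2) y 1 1 1 1 2 2 0 1 := by
  intro x y
  refine ⟨?_, ?_⟩
  · rw [moveDivisor]
    norm_num only [divisorTerm_zero, divisorTerm_one, divisorTerm_two, divisorTerm_four]
    have e1 : (x + 1 / 2 + y) / 2 = (x + y) / 2 + 1 / 4 := by ring
    have e2 : (x + y) / 2 + 1 / 4 + 1 / 2 = (x + y) / 2 + 3 / 4 := by ring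
    have e3 : 2 * x / 2 = x := by ring
    have e4 : 2 * y / 2 = y := by ring
    have e5 : (2 * x + 2 * y) / 4 = (x + y) / 2 := by ring
    have e7 : 1 / 2 + y = y + 1 / 2 := by ring
    simp only [e1, e2, e3, e4, e5, e7, Finsupp.single_neg]
    abel
  · rw [moveConst]
    norm_num only [constTerm_of_ne_zero, constTerm_half]
    simp

/-- `constTerm α m (-e) = -constTerm α m e`. [folklore] -/
theorem constTerm_neg (α : ℚ) (m e : ℤ) : constTerm α m (-e) = -constTerm α m e := by
  unfold constTerm
  split_ifs <;> simp [Finsupp.single_neg]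

/-! ## The two-duplication move DD and the twin-duplication move X9 are fully uniform -/

/-- **DD is a fully uniform move**: along `c ↦ c+t` the reflection-free two-duplication move
`((c+½−d, 2c+2d),(c,d)) ~ ((2c, c+d+½),(c+½−d, d))` (`B·B = 4^d·B·B`) has vanishing Γ-divisor and constant part,
for all rational `c, d`. [cite: AndrewsAskeyRoy1999, Thm 1.5.1] -/
theorem dd_isFullyUniform : ∀ (c d : ℚ), Summit.KontsevichZagierPeriods.FermatIsogeny.BetaProductSectorDefs.IsFullyUniform (c + 1 / 2 - d) (2 * c + 2 * d) c d (2 * c) (c + d + 1 / 2) (c + 1 / 2 - d) d 1 2 1 0 2 1 1 0 := by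
  intro c d
  refine ⟨?_, ?_⟩
  · rw [moveDivisor]
    norm_num only [divisorTerm_zero, divisorTerm_one, divisorTerm_two, divisorTerm_three]
    have e1 : (2 * c + 2 * d) / 2 = c + d := by ring
    have e2 : 2 * c / 2 = c := by ring
    have e3 : c + 1 / 2 - d + (2 * c + 2 * d) = 2 * c + (c + d + 1 / 2) := by ring
    simp only [e1, e2, e3, Finsupp.single_neg]
    abel
  · rw [moveConst]
    norm_num only [constTerm_of_ne_zero]
    simp [constTerm_neg]

/-- **X9 (twin duplication) is a fully uniform move**: along `(a,b) ↦ (a+t,b+t)` the reflection-free move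
`((a+b−½, b+½),(b, a+½−b)) ~ ((a+b−½, a+½−b),(a, 2b))` (`B·B = 4^{a−b}·B·B`) has vanishing Γ-divisor and constant part,
for all rational `a, b`. [cite: AndrewsAskeyRoy1999, Thm 1.5.1] -/
theorem twinDup_isFullyUniform : ∀ (a b : ℚ), Summit.KontsevichZagierPeriods.FermatIsogeny.BetaProductSectorDefs.IsFullyUniform (a + b - 1 / 2) (b + 1 / 2) b (a + 1 / 2 - b) (a + b - 1 / 2) (a + 1 / 2 - b) a (2 * b) 2 1 1 0 2 0 1 2 := by
  intro a b
  refine ⟨?_, ?_⟩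
  · rw [moveDivisor]
    norm_num only [divisorTerm_zero, divisorTerm_one, divisorTerm_two, divisorTerm_three]
    have e1 : 2 * a / 2 = a := by ring
    have e2 : 2 * b / 2 = b := by ring
    have e3 : a + b - 1 / 2 + (b + 1 / 2) = a + 2 * b := by ring
    have e4 : a + b - 1 / 2 + (a + 1 / 2 - b) = 2 * a := by ring
    have e5 : b + (a + 1 / 2 - b) = a + 1 / 2 := by ring
    simp only [e1, e2, e3, e4, e5, Finsupp.single_neg]
    abel
  · rw [moveConst]
    norm_num only [constTerm_of_ne_zero]
    simp [constTerm_neg]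

end Summit.KontsevichZagierPeriods.FermatIsogeny.BetaProductSectorStubs

end
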